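import Literature.Computability.Complexity.IterateFPPoly
import Literature.Computability.Complexity.ZIntBricks
import Literature.Computability.Complexity.StackLists
import HarnessLib

/-!
# List bricks: counted-loop combinators over coded lists in the `FP` string algebra

Trunk `CplxCore`, continuing `BrickAlgebra.lean` (records `⟨a₀, ⟨a₁, …⟩⟩`, the counted loop
`Brick.loopStep` with its semantics `Brick.iterate_loopStep`/`Brick.loopModel`) and
`IterateFPPoly.lean` (loops whose body grows by a polynomial of the kept first field). A list of
strings is coded as in `StackLists.lean`, `encList [a₁, …, a_k] = ⟨a₁, ⟨a₂, … ⟨a_k, ε⟩…⟩⟩`, so that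
`fstF`/`sndF` are head/tail and `boolPair` is cons. This file provides the list-processing layer a
table-manipulating machine is written in (the LLL basis-reduction machine, whose state is a matrix =
list of rows = lists of integer codes): every combinator is a **total** string function on records

  `⟨x, ⟨counter, ⟨params, list(s)…⟩⟩⟩`,

where `x` is the *yardstick* (kept first field: the loop runs `|x|` clocked rounds, of which the
first `⟦counter⟧ ≤ |x|` are active) and `params` is passed unchanged to the item function, which is
applied to the argument record `⟨x, ⟨params, item(s)⟩⟩`:

* the dynamics of `loopStep` on *arbitrary* records (`loopRun`, `cntRun`, `activeRounds`,
  `iterate_loopStep_eq`) and the potential method `potential_loopRun_le` for output sizes;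
* `dropLF`, `nthLF` (`L.drop k`, `L[k]`), `revOntoLF`/`takeRevLF` (reverse a prefix onto an
  accumulator) with the joint size bound `length_takeRevLF_add_dropLF_le`, `setNthLF` (`L.set i v`),
  `swapAdjLF` (exchange items `i`, `i+1`);
* `mapRevLF f`/`mapLF f` (map), `zipRevLF f`/`zipLF f` (zipWith), `zipFoldLF f` (fold over two
  lists: dot products); a one-list fold over the items of a coded list exists as `Brick.foldFn`
  (`ListFoldBricks.lean`);
* for each: membership in `FP` (given `f ∈ FP` and a growth bound on `f`), the value on coded lists
  (`_apply`, for canonical counters `⟦bin k⟧ = k ≤ |x|`), and an output-length bound valid on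
  **every** input: for an item function with `|f ⟨x, ⟨p, a⟩⟩| ≤ c |a| + P(|x|)` the map output has
  `≤ c |l| + |x| (2P(|x|) + 2)` symbols (`c = 1`: the shape under which loops nest; `c = 0`: item
  functions saturating at width `|x|`, giving *absolute* bounds; `c = 2`: one-off recodings; the
  in-order `mapLF` costs `+ 4` instead of `+ 2`).

Design: sources shrink in early (doubled) record fields, accumulators grow in the last (undoubled)
field; params never enter the growth allowance, only the yardstick does. (The tree holds the
nested-pair list coding twice: `encList` of `StackLists.lean`, used here, and `body` of
`CookReducibilityTransitive.lean`, whose head/tail facts `HashBricks.fstF_body`, `sndF_iterate_body`,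
`fstF_nil`, `sndF_nil` are twins of `fstF_encList`, `sndF_iterate_encList`, `fstF_nil`, `sndF_nil`
below; unary-indexed accessors of the same coding exist as `HashBricks.nthItemFn` and
`PRelSigPi.elemFn`/`elemOf` — `nthLF`/`dropLF` here take a binary counter clocked by the yardstick.)

## References

* S. Arora, B. Barak, *Computational Complexity: A Modern Approach*, CUP 2009, §1.3 (bounded loops,
  closure of polynomial time under composition), §0.1 (coding of tuples and lists).
-/

namespace Literature.Computability.Complexity

open _root_.Computability Polynomial

namespace Brick

/-! ### Coded lists: head, tail, cons -/

/-- Head of a coded list (`ε` for the empty list). [folklore] -/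
@[simp] theorem fstF_encList (L : List (List Bool)) : fstF (encList L) = L.headD [] := by
  cases L with
  | nil => rfl
  | cons a L => rw [encList_cons, fstF_boolPair]; rfl

/-- Tail of a coded list. [folklore] -/
@[simp] theorem sndF_encList (L : List (List Bool)) : sndF (encList L) = encList L.tail := by
  cases L with
  | nil => rfl
  | cons a L => rw [encList_cons, sndF_boolPair]; rfl

/-- The coded list is empty iff the list is. [folklore] -/
theorem encList_eq_nil_iff (L : List (List Bool)) : encList L = [] ↔ L = [] := by
  cases L with
  | nil => simp
  | cons a L => simp [encList_cons, boolPair]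

/-- `isNilFn` on a coded list. [folklore] -/
@[simp] theorem isNilFn_encList (L : List (List Bool)) : isNilFn (encList L) = [decide (L = [])] := by
  simp [isNilFn, encList_eq_nil_iff]

/-- `isNilFn ε = [1]`. [folklore] -/
@[simp] theorem isNilFn_nil : isNilFn ([] : List Bool) = [true] := rfl

/-- `isNilFn ⟨a, b⟩ = [0]`. [folklore] -/
@[simp] theorem isNilFn_boolPair (a b : List Bool) : isNilFn (boolPair a b) = [false] := by
  simp [isNilFn, boolPair]

/-- Dropping from a coded list by iterated tails. [folklore] -/
theorem sndF_iterate_encList (k : ℕ) : ∀ L : List (List Bool), sndF^[k] (encList L) = encList (L.drop k) := by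
  induction k with
  | zero => intro L; rfl
  | succ k ih => intro L; rw [Function.iterate_succ_apply, sndF_encList, ih, List.drop_tail]

/-- `sndF ε = ε`. [folklore] -/
@[simp] theorem sndF_nil : sndF ([] : List Bool) = [] := rfl

/-- `fstF ε = ε`. [folklore] -/
@[simp] theorem fstF_nil : fstF ([] : List Bool) = [] := rfl

/-- Iterated tails of `ε`. [folklore] -/
@[simp] theorem sndF_iterate_nil (k : ℕ) : sndF^[k] ([] : List Bool) = [] := by
  induction k with
  | zero => rfl
  | succ k ih => rw [Function.iterate_succ_apply, sndF_nil, ih]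

/-- Iterated tails shrink. [folklore] -/
theorem length_sndF_iterate_le (k : ℕ) : ∀ w : List Bool, (sndF^[k] w).length ≤ w.length := by
  induction k with
  | zero => intro w; simp
  | succ k ih =>
    intro w
    rw [Function.iterate_succ_apply]
    have h := length_fstF_sndF_le w
    exact (ih _).trans (by omega)

/-- More tails, shorter. [folklore] -/
theorem length_sndF_iterate_anti {a b : ℕ} (h : a ≤ b) (w : List Bool) : (sndF^[b] w).length ≤ (sndF^[a] w).length := by
  obtain ⟨d, rfl⟩ := Nat.exists_eq_add_of_le h
  rw [Nat.add_comm, Function.iterate_add_apply]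
  exact length_sndF_iterate_le d _

/-- The field after `sndPow i` starts with `nthF (i+1)`. [folklore] -/
@[simp] theorem fstF_sndPow (i : ℕ) : ∀ z : List Bool, fstF (sndPow i z) = nthF (i + 1) z := by
  induction i with
  | zero => intro z; rfl
  | succ i ih => intro z; exact ih (sndF z)

/-- The tail after `sndPow i` is `sndPow (i+1)`. [folklore] -/
@[simp] theorem sndF_sndPow (i : ℕ) : ∀ z : List Bool, sndF (sndPow i z) = sndPow (i + 1) z := by
  induction i with
  | zero => intro z; rfl
  | succ i ih => intro z; exact ih (sndF z)

/-! ### The dynamics of `loopStep` on arbitrary records -/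

/-- A loop at a *nonempty* counter `c` steps: the counter becomes `bin (⟦c⟧ - 1)` and the state
becomes `body z`. [folklore] -/
theorem loopStep_of_ne_nil (body : List Bool → List Bool) (x s : List Bool) {c : List Bool} (hc : c ≠ []) :
    loopStep body (boolPair x (boolPair c s)) =
      boolPair x (boolPair (encodeNat (bitsToNat c - 1)) (body (boolPair x (boolPair c s)))) := by
  rw [loopStep, iteFn_apply_false (by simp [isNilFn, hc])]
  simp [predCntF_apply]

/-- The counter after `n` rounds (the counter dynamics does not depend on the state). [folklore] -/
def cntRun : List Bool → ℕ → List Bool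
  | c, 0 => c
  | c, n + 1 => if c = [] then c else cntRun (encodeNat (bitsToNat c - 1)) n

/-- The number of *active* rounds among `n` from counter `c`. [folklore] -/
def activeRounds : List Bool → ℕ → ℕ
  | _, 0 => 0
  | c, n + 1 => if c = [] then 0 else activeRounds (encodeNat (bitsToNat c - 1)) n + 1

/-- The state after `n` rounds of `loopStep body` from `⟨x, ⟨c, s⟩⟩`. [folklore] -/
def loopRun (body : List Bool → List Bool) (x : List Bool) : List Bool → ℕ → List Bool → List Bool
  | _, 0, s => s
  | c, n + 1, s => if c = [] then s else loopRun body x (encodeNat (bitsToNat c - 1)) n (body (boolPair x (boolPair c s)))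

/-- **`n` rounds of a counted loop on a record.** [folklore] -/
theorem iterate_loopStep_eq (body : List Bool → List Bool) (x : List Bool) :
    ∀ (n : ℕ) (c s : List Bool), (loopStep body)^[n] (boolPair x (boolPair c s)) =
      boolPair x (boolPair (cntRun c n) (loopRun body x c n s))
  | 0, c, s => rfl
  | n + 1, c, s => by
    rw [Function.iterate_succ_apply]
    by_cases hc : c = []
    · subst hc
      rw [loopStep_zero, iterate_loopStep_eq body x n]
      cases n <;> simp [cntRun, loopRun]
    · rw [loopStep_of_ne_nil body x s hc, iterate_loopStep_eq body x n]
      simp [cntRun, loopRun, hc]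

/-- At most `n` of `n` rounds are active. [folklore] -/
theorem activeRounds_le : ∀ (c : List Bool) (n : ℕ), activeRounds c n ≤ n
  | _, 0 => le_rfl
  | c, n + 1 => by
    unfold activeRounds
    split_ifs
    · exact Nat.zero_le _
    · exact Nat.succ_le_succ (activeRounds_le _ n)

/-- From a canonical counter `bin k`, exactly `min k n` rounds are active. [folklore] -/
theorem activeRounds_encodeNat : ∀ (k n : ℕ), activeRounds (encodeNat k) n = min k n
  | k, 0 => by simp [activeRounds]
  | 0, n + 1 => by simp [activeRounds, TokConv.encodeNat_zero']
  | k + 1, n + 1 => by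
    rw [activeRounds, if_neg (encodeNat_ne_nil_of_pos (Nat.succ_pos k)), bitsToNat_encodeNat, Nat.add_sub_cancel,
      activeRounds_encodeNat k n, Nat.succ_min_succ]

/-- Bumping the counter to the canonical successor of its value does not decrease the number of
active rounds: `activeRounds c n ≤ activeRounds (bin (⟦c⟧ + 1)) n`. [folklore] -/
theorem activeRounds_le_succ (c : List Bool) (n : ℕ) : activeRounds c n ≤ activeRounds (encodeNat (bitsToNat c + 1)) n := by
  rw [activeRounds_encodeNat]
  cases n with
  | zero => simp [activeRounds]
  | succ n =>
    unfold activeRounds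
    split_ifs with hc
    · exact Nat.zero_le _
    · rw [activeRounds_encodeNat]; omega

/-- **The potential method**: if one active round raises a potential `Φ` of the state by at most
`K`, then `n` rounds raise it by at most `activeRounds · K ≤ n K`. [folklore] -/
theorem potential_loopRun_le {body : List Bool → List Bool} {x : List Bool} (Φ : List Bool → ℕ) (K : ℕ)
    (h : ∀ c s, c ≠ [] → Φ (body (boolPair x (boolPair c s))) ≤ Φ s + K) :
    ∀ (n : ℕ) (c s : List Bool), Φ (loopRun body x c n s) ≤ Φ s + activeRounds c n * K
  | 0, c, s => by simp [loopRun]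
  | n + 1, c, s => by
    unfold loopRun activeRounds
    split_ifs with hc
    · simp
    · have h1 := h c s hc
      have h2 := potential_loopRun_le Φ K h n (encodeNat (bitsToNat c - 1)) (body (boolPair x (boolPair c s)))
      rw [Nat.succ_mul]; omega

/-- A loop whose body returns the state `s` unchanged at every counter keeps `s`. [folklore] -/
theorem loopRun_fixed {body : List Bool → List Bool} {x s : List Bool}
    (h : ∀ c, body (boolPair x (boolPair c s)) = s) : ∀ (n : ℕ) (c : List Bool), loopRun body x c n s = s
  | 0, c => rfl
  | n + 1, c => by
    unfold loopRun; split_ifs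
    · rfl
    · rw [h, loopRun_fixed h n]

/-- The canonical-counter model of `BrickAlgebra.lean` is the run: `loopRun … (bin k) n = loopModel … k`
for `k ≤ n`. [folklore] -/
theorem loopRun_encodeNat (body : List Bool → List Bool) (x : List Bool) :
    ∀ (k n : ℕ) (s : List Bool), k ≤ n → loopRun body x (encodeNat k) n s = loopModel body x k s
  | 0, n, s, _ => by cases n <;> simp [loopRun, loopModel, TokConv.encodeNat_zero']
  | k + 1, 0, s, h => by omega
  | k + 1, n + 1, s, h => by
    rw [loopRun, if_neg (encodeNat_ne_nil_of_pos (Nat.succ_pos k)), bitsToNat_encodeNat, Nat.add_sub_cancel,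
      loopRun_encodeNat body x k n _ (by omega), loopModel]

/-! ### The clocked loop over the yardstick -/

/-- The clocked loop of a body over the yardstick `x = fstF z`: `|x|` rounds of `loopStep body`.
[cite: AroraBarak2009, §1.3 (bounded loops)] -/
noncomputable def loopX (body : List Bool → List Bool) (z : List Bool) : List Bool :=
  (loopStep body)^[(fstF z).length] z

/-- `loopX body ∈ FP` for a body of polynomial growth in the yardstick. [folklore] -/
theorem loopX_mem_FP {body : List Bool → List Bool} (h : body ∈ FP) {P : Polynomial ℕ}
    (hbody : ∀ z, (body z).length ≤ (sndPow 1 z).length + P.eval (fstF z).length) : loopX body ∈ FP := by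
  have := loopFn_mem_FP_of_poly h _ hbody X
  simp only [eval_X] at this
  exact this

/-- **Semantics of `loopX`** on a record `⟨x, ⟨bin k, s⟩⟩` with `k ≤ |x|`. [folklore] -/
theorem loopX_apply (body : List Bool → List Bool) (x s : List Bool) {k : ℕ} (hk : k ≤ x.length) :
    loopX body (boolPair x (boolPair (encodeNat k) s)) = boolPair x (boolPair [] (loopModel body x k s)) := by
  rw [loopX, fstF_boolPair]
  exact iterate_loopStep body x k _ s hk

/-- `loopX` on an arbitrary record. [folklore] -/
theorem loopX_record (body : List Bool → List Bool) (x c s : List Bool) :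
    loopX body (boolPair x (boolPair c s)) = boolPair x (boolPair (cntRun c x.length) (loopRun body x c x.length s)) := by
  rw [loopX, fstF_boolPair, iterate_loopStep_eq]

/-- The state field of `loopX` on a record. [folklore] -/
theorem sndPow_one_loopX_record (body : List Bool → List Bool) (x c s : List Bool) :
    sndPow 1 (loopX body (boolPair x (boolPair c s))) = loopRun body x c x.length s := by
  rw [loopX_record]; simp

/-- A counted loop keeps the yardstick (file-local; public twin: `Brick.fstF_iterate_loopStep` of
`IntVectorBricks.lean`, not imported here). [folklore] -/
private theorem fstF_loopStep_iterate (body : List Bool → List Bool) (z : List Bool) (n : ℕ) :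
    fstF ((loopStep body)^[n] z) = fstF z := by
  induction n with
  | zero => rfl
  | succ n ih => rw [Function.iterate_succ_apply', fstF_loopStep, ih]

/-- `loopX` keeps the yardstick. [folklore] -/
@[simp] theorem fstF_loopX (body : List Bool → List Bool) (z : List Bool) : fstF (loopX body z) = fstF z :=
  fstF_loopStep_iterate body z _

/-- The record re-packer `z ↦ ⟨fstF z, ⟨nthF 1 z, sndPow 1 z⟩⟩` (a no-op on records; it makes every
loop start from a genuine record). [folklore] -/
noncomputable def repack3 : List Bool → List Bool := fanoutFn fstF (fanoutFn (nthF 1) (sndPow 1))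

/-- `repack3` on a record. [folklore] -/
@[simp] theorem repack3_boolPair (x c s : List Bool) : repack3 (boolPair x (boolPair c s)) = boolPair x (boolPair c s) := by
  simp [repack3]

/-- `repack3 ∈ FP`. [folklore] -/
theorem repack3_mem_FP : repack3 ∈ FP := fanoutFn_mem_FP fstF_mem_FP (fanoutFn_mem_FP (nthF_mem_FP 1) (sndPow_mem_FP 1))

/-- `repack3 z` is a record with the fields of `z`. [folklore] -/
theorem repack3_eq (z : List Bool) : repack3 z = boolPair (fstF z) (boolPair (nthF 1 z) (sndPow 1 z)) := by
  simp [repack3]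

/-- `|repack3 z| ≤ |z| + 4`. [folklore] -/
theorem length_repack3_le (z : List Bool) : (repack3 z).length ≤ z.length + 4 := by
  have h0 := length_fstF_sndF_le z
  have h1 := length_nthF_succ_add_sndPow_succ_le 0 z
  simp only [sndPow_zero, Nat.reduceAdd] at h1
  rw [repack3_eq, length_boolPair, length_boolPair]
  omega

/-! ### `drop` and `nth` -/

/-- Body of `dropLF`: replace the state (a coded list) by its tail. [folklore] -/
noncomputable def dropBody : List Bool → List Bool := sndF ∘ sndPow 1

/-- **`dropLF ⟨x, ⟨bin k, encList L⟩⟩ = encList (L.drop k)`** (`k ≤ |x|`). [folklore] -/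
noncomputable def dropLF : List Bool → List Bool := sndPow 1 ∘ loopX dropBody ∘ repack3

/-- The run of the drop loop: iterated tails. [folklore] -/
theorem loopRun_dropBody (x : List Bool) : ∀ (n : ℕ) (c l : List Bool),
    loopRun dropBody x c n l = sndF^[activeRounds c n] l
  | 0, c, l => rfl
  | n + 1, c, l => by
    unfold loopRun activeRounds
    split_ifs with hc
    · rfl
    · rw [loopRun_dropBody x n, show dropBody (boolPair x (boolPair c l)) = sndF l by simp [dropBody],
        Function.iterate_succ_apply]

/-- `dropLF` on a record: `sndF^[activeRounds c |x|] l`. [folklore] -/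
theorem dropLF_record (x c l : List Bool) : dropLF (boolPair x (boolPair c l)) = sndF^[activeRounds c x.length] l := by
  rw [dropLF, Function.comp_apply, Function.comp_apply, repack3_boolPair, sndPow_one_loopX_record, loopRun_dropBody]

/-- Semantics of `dropLF`. [folklore] -/
theorem dropLF_apply (x : List Bool) {k : ℕ} (hk : k ≤ x.length) (L : List (List Bool)) :
    dropLF (boolPair x (boolPair (encodeNat k) (encList L))) = encList (L.drop k) := by
  rw [dropLF_record, activeRounds_encodeNat, min_eq_left hk, sndF_iterate_encList]

/-- Growth of the drop body: none. [folklore] -/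
theorem length_dropBody_le (z : List Bool) : (dropBody z).length ≤ (sndPow 1 z).length + (0 : Polynomial ℕ).eval (fstF z).length := by
  have := length_nthF_succ_add_sndPow_succ_le 1 z
  simp [dropBody] at this ⊢; omega

/-- `dropLF ∈ FP`. [folklore] -/
theorem dropLF_mem_FP : dropLF ∈ FP :=
  comp_mem_FP (sndPow_mem_FP 1) (comp_mem_FP (loopX_mem_FP (comp_mem_FP sndF_mem_FP (sndPow_mem_FP 1)) length_dropBody_le)
    repack3_mem_FP)

/-- **`dropLF` never lengthens the list**: `|dropLF z| ≤ |sndPow 1 z|`. [folklore] -/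
theorem length_dropLF_le (z : List Bool) : (dropLF z).length ≤ (sndPow 1 z).length := by
  have e : dropLF z = dropLF (repack3 z) := by simp [dropLF, repack3_eq]
  rw [e, repack3_eq, dropLF_record]
  exact length_sndF_iterate_le _ _

/-- **`nthLF ⟨x, ⟨bin k, encList L⟩⟩ = L[k]`** (default `ε`; `k ≤ |x|`). [folklore] -/
noncomputable def nthLF : List Bool → List Bool := fstF ∘ dropLF

/-- Semantics of `nthLF`. [folklore] -/
theorem nthLF_apply (x : List Bool) {k : ℕ} (hk : k ≤ x.length) (L : List (List Bool)) :
    nthLF (boolPair x (boolPair (encodeNat k) (encList L))) = L.getD k [] := by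
  rw [nthLF, Function.comp_apply, dropLF_apply x hk, fstF_encList]
  cases h : L.drop k with
  | nil => simp [List.getD_eq_getElem?_getD, List.getElem?_eq_none (List.drop_eq_nil_iff.1 h)]
  | cons a l =>
    have hlt : k < L.length := by
      by_contra hle; rw [List.drop_eq_nil_of_le (not_lt.1 hle)] at h; simp at h
    have ha : a = L[k] := by
      rw [List.drop_eq_getElem_cons hlt] at h
      simpa using (List.cons.inj h).1.symm
    simp [List.getD_eq_getElem?_getD, List.getElem?_eq_getElem hlt, ha]

/-- `nthLF ∈ FP`. [folklore] -/
theorem nthLF_mem_FP : nthLF ∈ FP := comp_mem_FP fstF_mem_FP dropLF_mem_FP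

/-- `|nthLF z| ≤ |sndPow 1 z|`. [folklore] -/
theorem length_nthLF_le (z : List Bool) : (nthLF z).length ≤ (sndPow 1 z).length := by
  have h1 := length_dropLF_le z
  have h2 := length_fstF_sndF_le (dropLF z)
  rw [nthLF, Function.comp_apply]; omega

/-! ### Reversing a prefix onto an accumulator; `take` reversed -/

/-- The record re-packer with four fields `⟨fstF z, ⟨nthF 1 z, ⟨nthF 2 z, sndPow 2 z⟩⟩⟩`. [folklore] -/
noncomputable def repack4 : List Bool → List Bool := fanoutFn fstF (fanoutFn (nthF 1) (fanoutFn (nthF 2) (sndPow 2)))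

/-- `repack4` on a record. [folklore] -/
@[simp] theorem repack4_boolPair (x c a b : List Bool) :
    repack4 (boolPair x (boolPair c (boolPair a b))) = boolPair x (boolPair c (boolPair a b)) := by
  simp [repack4]

/-- `repack4 z` spelled out. [folklore] -/
theorem repack4_eq (z : List Bool) : repack4 z = boolPair (fstF z) (boolPair (nthF 1 z) (boolPair (nthF 2 z) (sndPow 2 z))) := by
  simp [repack4]

/-- `repack4 ∈ FP`. [folklore] -/
theorem repack4_mem_FP : repack4 ∈ FP :=
  fanoutFn_mem_FP fstF_mem_FP (fanoutFn_mem_FP (nthF_mem_FP 1) (fanoutFn_mem_FP (nthF_mem_FP 2) (sndPow_mem_FP 2)))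

/-- Body of `revOntoLF` on `⟨x, ⟨cnt, ⟨src, acc⟩⟩⟩`: if `src` is empty keep the state, else move
its head onto `acc` (`⟨tl src, ⟨hd src, acc⟩⟩`). [folklore] -/
noncomputable def revOntoBody : List Bool → List Bool :=
  iteFn (isNilFn ∘ nthF 2) (sndPow 1) (fanoutFn (sndF ∘ nthF 2) (fanoutFn (fstF ∘ nthF 2) (sndPow 2)))

/-- **`revOntoLF ⟨x, ⟨bin k, ⟨encList S, encList A⟩⟩⟩ = encList ((S.take k).reverse ++ A)`**
(`k ≤ |x|`). [folklore] -/
noncomputable def revOntoLF : List Bool → List Bool := sndPow 2 ∘ loopX revOntoBody ∘ repack4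

/-- The reversing body on a record whose state is a pair `⟨src, acc⟩`. [folklore] -/
theorem revOntoBody_pair (x c src acc : List Bool) :
    revOntoBody (boolPair x (boolPair c (boolPair src acc))) =
      if src = [] then boolPair src acc else boolPair (sndF src) (boolPair (fstF src) acc) := by
  rw [revOntoBody, iteFn_of_oneBit (oneBit_isNilFn.comp _)]
  by_cases h : src = []
  · rw [if_pos (by simp [isNilFn, nthF, h]), if_pos h]; simp [sndPow]
  · rw [if_neg (by simp [isNilFn, nthF, h]), if_neg h]; simp [nthF, sndPow]

/-- The model of the reversing loop (canonical counter). [folklore] -/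
theorem loopModel_revOntoBody (x : List Bool) : ∀ (k : ℕ) (S A : List (List Bool)),
    loopModel revOntoBody x k (boolPair (encList S) (encList A)) =
      boolPair (encList (S.drop k)) (encList ((S.take k).reverse ++ A))
  | 0, S, A => by simp [loopModel]
  | k + 1, [], A => by
    rw [loopModel, revOntoBody_pair, if_pos (by simp), loopModel_revOntoBody x k [] A]; simp
  | k + 1, a :: S, A => by
    rw [loopModel, revOntoBody_pair, if_neg (by simp [encList_cons, boolPair])]
    simp only [encList_cons, fstF_boolPair, sndF_boolPair]
    rw [← encList_cons, loopModel_revOntoBody x k S (a :: A)]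
    simp

/-- Semantics of `revOntoLF`. [folklore] -/
theorem revOntoLF_apply (x : List Bool) {k : ℕ} (hk : k ≤ x.length) (S A : List (List Bool)) :
    revOntoLF (boolPair x (boolPair (encodeNat k) (boolPair (encList S) (encList A)))) =
      encList ((S.take k).reverse ++ A) := by
  rw [revOntoLF, Function.comp_apply, Function.comp_apply, repack4_boolPair, loopX_apply _ _ _ hk, loopModel_revOntoBody]
  simp

/-- **The run of the reversing loop on arbitrary data**: after `n` rounds from `⟨src, acc⟩` the
source is `sndF^[ρ] src` (`ρ` active rounds) and the accumulator has gained at most what the source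
lost, plus `2` per round. [folklore] -/
theorem loopRun_revOntoBody (x : List Bool) : ∀ (n : ℕ) (c src acc : List Bool), ∃ acc' : List Bool,
    loopRun revOntoBody x c n (boolPair src acc) = boolPair (sndF^[activeRounds c n] src) acc' ∧
      acc'.length + (sndF^[activeRounds c n] src).length ≤ src.length + acc.length + 2 * activeRounds c n
  | 0, c, src, acc => ⟨acc, rfl, by simp only [activeRounds, Function.iterate_zero, id_eq]; omega⟩
  | n + 1, c, src, acc => by
    unfold loopRun activeRounds
    split_ifs with hc
    · exact ⟨acc, rfl, by simp only [Function.iterate_zero, id_eq]; omega⟩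
    · rw [revOntoBody_pair]
      by_cases hs : src = []
      · subst hs
        rw [if_pos rfl]
        obtain ⟨acc', h1, h2⟩ := loopRun_revOntoBody x n (encodeNat (bitsToNat c - 1)) [] acc
        refine ⟨acc', ?_, ?_⟩
        · rw [h1]; simp
        · simp only [sndF_iterate_nil, List.length_nil] at h2 ⊢; omega
      · rw [if_neg hs]
        obtain ⟨acc', h1, h2⟩ := loopRun_revOntoBody x n (encodeNat (bitsToNat c - 1)) (sndF src) (boolPair (fstF src) acc)
        refine ⟨acc', ?_, ?_⟩
        · rw [h1, ← Function.iterate_succ_apply sndF]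
        · have h3 := length_fstF_sndF_le src
          rw [length_boolPair] at h2
          rw [Function.iterate_succ_apply]
          unfold fstF sndF at *
          omega

/-- `revOntoLF` in terms of the run: the accumulator after `|x|` rounds. [folklore] -/
theorem revOntoLF_eq (z : List Bool) :
    revOntoLF z = sndF (loopRun revOntoBody (fstF z) (nthF 1 z) (fstF z).length (boolPair (nthF 2 z) (sndPow 2 z))) := by
  rw [revOntoLF, Function.comp_apply, Function.comp_apply, repack4_eq, ← sndPow_one_loopX_record]; rfl

/-- Growth of the reversing body (total length): at most `4` per round. [folklore] -/
theorem length_revOntoBody_le (z : List Bool) :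
    (revOntoBody z).length ≤ (sndPow 1 z).length + (4 : Polynomial ℕ).eval (fstF z).length := by
  have h1 := length_nthF_succ_add_sndPow_succ_le 1 z
  have h2 := length_fstF_sndF_le (nthF 2 z)
  rw [revOntoBody, iteFn_of_oneBit (oneBit_isNilFn.comp _)]
  split_ifs
  · simp
  · simp only [fanoutFn_apply, length_boolPair, Function.comp_apply, eval_ofNat, Nat.reduceAdd] at h1 ⊢
    omega

/-- `revOntoLF ∈ FP`. [folklore] -/
theorem revOntoLF_mem_FP : revOntoLF ∈ FP :=
  comp_mem_FP (sndPow_mem_FP 2) (comp_mem_FP (loopX_mem_FP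
    (iteFn_mem_FP (comp_mem_FP isNilFn_mem_FP (nthF_mem_FP 2)) (sndPow_mem_FP 1)
      (fanoutFn_mem_FP (comp_mem_FP sndF_mem_FP (nthF_mem_FP 2)) (fanoutFn_mem_FP (comp_mem_FP fstF_mem_FP (nthF_mem_FP 2)) (sndPow_mem_FP 2))))
    length_revOntoBody_le) repack4_mem_FP)

/-- **Output size of `revOntoLF`**: `≤ |src| + |acc| + 2|x|` (in record terms
`|nthF 2 z| + |sndPow 2 z| + 2 |fstF z|`), together with the bound on the unread source. [folklore] -/
theorem length_revOntoLF_add_le (z : List Bool) :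
    (revOntoLF z).length + (sndF^[activeRounds (nthF 1 z) (fstF z).length] (nthF 2 z)).length ≤
      (nthF 2 z).length + (sndPow 2 z).length + 2 * (fstF z).length := by
  rw [revOntoLF_eq]
  obtain ⟨acc', h1, h2⟩ := loopRun_revOntoBody (fstF z) (fstF z).length (nthF 1 z) (nthF 2 z) (sndPow 2 z)
  rw [h1, sndF_boolPair]
  have := activeRounds_le (nthF 1 z) (fstF z).length
  omega

/-- Output size of `revOntoLF`, plain form. [folklore] -/
theorem length_revOntoLF_le (z : List Bool) :
    (revOntoLF z).length ≤ (nthF 2 z).length + (sndPow 2 z).length + 2 * (fstF z).length := by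
  have := length_revOntoLF_add_le z; omega

/-- **`takeRevLF ⟨x, ⟨bin k, encList L⟩⟩ = encList (L.take k).reverse`** (`k ≤ |x|`; for
`k ≥ |L|` this is the reversal of `L`). [folklore] -/
noncomputable def takeRevLF : List Bool → List Bool :=
  revOntoLF ∘ fanoutFn fstF (fanoutFn (nthF 1) (fanoutFn (sndPow 1) (fun _ => [])))

/-- Semantics of `takeRevLF`. [folklore] -/
theorem takeRevLF_apply (x : List Bool) {k : ℕ} (hk : k ≤ x.length) (L : List (List Bool)) :
    takeRevLF (boolPair x (boolPair (encodeNat k) (encList L))) = encList (L.take k).reverse := by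
  have := revOntoLF_apply x hk L []
  simp only [List.append_nil, encList_nil] at this
  simpa [takeRevLF] using this

/-- `takeRevLF ∈ FP`. [folklore] -/
theorem takeRevLF_mem_FP : takeRevLF ∈ FP :=
  comp_mem_FP revOntoLF_mem_FP (fanoutFn_mem_FP fstF_mem_FP (fanoutFn_mem_FP (nthF_mem_FP 1)
    (fanoutFn_mem_FP (sndPow_mem_FP 1) (const_mem_FP _))))

/-- **Joint size bound for `takeRevLF` and the unread part** (same counter, same yardstick):
`|takeRevLF z| + |sndF^[ρ] l| ≤ |l| + 2|x|`. [folklore] -/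
theorem length_takeRevLF_add_le (z : List Bool) :
    (takeRevLF z).length + (sndF^[activeRounds (nthF 1 z) (fstF z).length] (sndPow 1 z)).length ≤
      (sndPow 1 z).length + 2 * (fstF z).length := by
  have h := length_revOntoLF_add_le (boolPair (fstF z) (boolPair (nthF 1 z) (boolPair (sndPow 1 z) [])))
  simp only [fstF_boolPair, nthF_succ_boolPair, nthF_zero_boolPair, sndPow_succ_boolPair, sndPow_zero, sndF_boolPair,
    List.length_nil, add_zero] at h
  simpa [takeRevLF] using h

/-- Output size of `takeRevLF`: `≤ |l| + 2|x|`. [folklore] -/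
theorem length_takeRevLF_le (z : List Bool) : (takeRevLF z).length ≤ (sndPow 1 z).length + 2 * (fstF z).length := by
  have := length_takeRevLF_add_le z; omega

/-- `dropLF` in terms of the run. [folklore] -/
theorem dropLF_eq (z : List Bool) : dropLF z = sndF^[activeRounds (nthF 1 z) (fstF z).length] (sndPow 1 z) := by
  have e : dropLF z = dropLF (repack3 z) := by simp [dropLF, repack3_eq]
  rw [e, repack3_eq, dropLF_record]

/-- **`takeRevLF` and `dropLF` split the list**: `|takeRevLF z| + |dropLF z| ≤ |l| + 2|x|`. [folklore] -/
theorem length_takeRevLF_add_dropLF_le (z : List Bool) :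
    (takeRevLF z).length + (dropLF z).length ≤ (sndPow 1 z).length + 2 * (fstF z).length := by
  rw [dropLF_eq]; exact length_takeRevLF_add_le z

/-! ### `set` and the exchange of two adjacent items -/

/-- The successor of the counter field: `bin (⟦cnt⟧ + 1)`. [folklore] -/
noncomputable def succCntF : List Bool → List Bool := addFn ∘ fanoutFn (nthF 1) (fun _ => [true])

/-- `succCntF z = bin (⟦nthF 1 z⟧ + 1)`. [folklore] -/
theorem succCntF_eq (z : List Bool) : succCntF z = encodeNat (bitsToNat (nthF 1 z) + 1) := by
  simp [succCntF]

/-- `succCntF ∈ FP`. [folklore] -/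
theorem succCntF_mem_FP : succCntF ∈ FP := comp_mem_FP addFn_mem_FP (fanoutFn_mem_FP (nthF_mem_FP 1) (const_mem_FP _))

/-- The reversed prefix `takeRev cnt l` of the record `⟨x, ⟨cnt, ⟨v, l⟩⟩⟩`. [folklore] -/
noncomputable def setPreF : List Bool → List Bool := takeRevLF ∘ fanoutFn fstF (fanoutFn (nthF 1) (sndPow 2))

/-- The suffix `drop (cnt+1) l` of the record `⟨x, ⟨cnt, ⟨v, l⟩⟩⟩`. [folklore] -/
noncomputable def setPostF : List Bool → List Bool := dropLF ∘ fanoutFn fstF (fanoutFn succCntF (sndPow 2))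

/-- **`setNthLF ⟨x, ⟨bin i, ⟨v, encList L⟩⟩⟩ = encList (L.set i v)`** (`i < |L|`, `i + 1 ≤ |x|`): the
reversed prefix of length `i` reversed back onto `v :: L.drop (i+1)`. [folklore] -/
noncomputable def setNthLF : List Bool → List Bool :=
  revOntoLF ∘ fanoutFn fstF (fanoutFn (nthF 1) (fanoutFn setPreF (fanoutFn (nthF 2) setPostF)))

/-- **Semantics of `setNthLF`.** [folklore] -/
theorem setNthLF_apply (x : List Bool) {i : ℕ} (hi : i + 1 ≤ x.length) (v : List Bool) {L : List (List Bool)}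
    (hil : i < L.length) :
    setNthLF (boolPair x (boolPair (encodeNat i) (boolPair v (encList L)))) = encList (L.set i v) := by
  simp only [setNthLF, setPreF, setPostF, Function.comp_apply, fanoutFn_apply, fstF_boolPair, nthF_succ_boolPair,
    nthF_zero_boolPair, sndPow_succ_boolPair, sndPow_zero, sndF_boolPair, succCntF_eq, bitsToNat_encodeNat]
  rw [takeRevLF_apply x (by omega), dropLF_apply x hi, ← encList_cons, revOntoLF_apply x (by omega),
    List.take_of_length_le (by simp), List.reverse_reverse, List.set_eq_take_append_cons_drop, if_pos hil]

/-- `setNthLF ∈ FP`. [folklore] -/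
theorem setNthLF_mem_FP : setNthLF ∈ FP :=
  comp_mem_FP revOntoLF_mem_FP (fanoutFn_mem_FP fstF_mem_FP (fanoutFn_mem_FP (nthF_mem_FP 1)
    (fanoutFn_mem_FP (comp_mem_FP takeRevLF_mem_FP (fanoutFn_mem_FP fstF_mem_FP (fanoutFn_mem_FP (nthF_mem_FP 1) (sndPow_mem_FP 2))))
      (fanoutFn_mem_FP (nthF_mem_FP 2) (comp_mem_FP dropLF_mem_FP (fanoutFn_mem_FP fstF_mem_FP
        (fanoutFn_mem_FP succCntF_mem_FP (sndPow_mem_FP 2))))))))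

/-- **Output size of `setNthLF`**: `≤ |l| + 2|v| + 4|x| + 2` (`l = sndPow 2 z`, `v = nthF 2 z`). [folklore] -/
theorem length_setNthLF_le (z : List Bool) :
    (setNthLF z).length ≤ (sndPow 2 z).length + 2 * (nthF 2 z).length + 4 * (fstF z).length + 2 := by
  rw [setNthLF, Function.comp_apply]
  set w := fanoutFn fstF (fanoutFn (nthF 1) (fanoutFn setPreF (fanoutFn (nthF 2) setPostF))) z with hw
  have h := length_revOntoLF_le w
  have e2 : nthF 2 w = setPreF z := by simp [hw]
  have e3 : sndPow 2 w = boolPair (nthF 2 z) (setPostF z) := by simp [hw]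
  have e0 : fstF w = fstF z := by simp [hw]
  rw [e2, e3, e0, length_boolPair] at h
  -- the prefix and the unread part
  set u := fanoutFn fstF (fanoutFn (nthF 1) (sndPow 2)) z with hu
  have hpre : setPreF z = takeRevLF u := by simp [setPreF, hu]
  have hj := length_takeRevLF_add_le u
  have eu0 : fstF u = fstF z := by simp [hu]
  have eu1 : nthF 1 u = nthF 1 z := by simp [hu]
  have eu2 : sndPow 1 u = sndPow 2 z := by simp [hu]
  rw [eu0, eu1, eu2] at hj
  -- the suffix is no longer than the unread part
  have hpost : (setPostF z).length ≤ (sndF^[activeRounds (nthF 1 z) (fstF z).length] (sndPow 2 z)).length := by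
    have : setPostF z = sndF^[activeRounds (encodeNat (bitsToNat (nthF 1 z) + 1)) (fstF z).length] (sndPow 2 z) := by
      rw [setPostF, Function.comp_apply, dropLF_eq]; simp [succCntF_eq]
    rw [this]
    exact length_sndF_iterate_anti (activeRounds_le_succ _ _) _
  rw [hpre] at h
  omega

/-- **Exchange of two adjacent items**: `swapAdjLF ⟨x, ⟨bin j, encList L⟩⟩ = encList (L with L[j], L[j+1]
exchanged)` — the reversed prefix of length `j` reversed back onto `L[j+1] :: L[j] :: L.drop (j+2)`.
[folklore] -/
noncomputable def swapAdjLF : List Bool → List Bool :=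
  revOntoLF ∘ fanoutFn fstF (fanoutFn (nthF 1) (fanoutFn takeRevLF
    (fanoutFn (fstF ∘ sndF ∘ dropLF) (fanoutFn (fstF ∘ dropLF) (sndF ∘ sndF ∘ dropLF)))))

/-- **Semantics of `swapAdjLF`** (`j + 2 ≤ |L|`, `j ≤ |x|`). [folklore] -/
theorem swapAdjLF_apply (x : List Bool) {j : ℕ} (hj : j ≤ x.length) {L : List (List Bool)} (hjL : j + 2 ≤ L.length) :
    swapAdjLF (boolPair x (boolPair (encodeNat j) (encList L))) =
      encList (L.take j ++ L[j + 1]'(by omega) :: L[j]'(by omega) :: L.drop (j + 2)) := by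
  have hd : L.drop j = L[j]'(by omega) :: L[j + 1]'(by omega) :: L.drop (j + 2) := by
    rw [List.drop_eq_getElem_cons (by omega : j < L.length), List.drop_eq_getElem_cons (by omega : j + 1 < L.length)]
  simp only [swapAdjLF, Function.comp_apply, fanoutFn_apply, fstF_boolPair, nthF_succ_boolPair, nthF_zero_boolPair]
  rw [takeRevLF_apply x hj, dropLF_apply x hj, hd]
  simp only [encList_cons, fstF_boolPair, sndF_boolPair]
  rw [← encList_cons, ← encList_cons, revOntoLF_apply x hj, List.take_of_length_le (by simp), List.reverse_reverse]

/-- `swapAdjLF ∈ FP`. [folklore] -/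
theorem swapAdjLF_mem_FP : swapAdjLF ∈ FP :=
  comp_mem_FP revOntoLF_mem_FP (fanoutFn_mem_FP fstF_mem_FP (fanoutFn_mem_FP (nthF_mem_FP 1) (fanoutFn_mem_FP takeRevLF_mem_FP
    (fanoutFn_mem_FP (comp_mem_FP fstF_mem_FP (comp_mem_FP sndF_mem_FP dropLF_mem_FP))
      (fanoutFn_mem_FP (comp_mem_FP fstF_mem_FP dropLF_mem_FP) (comp_mem_FP sndF_mem_FP (comp_mem_FP sndF_mem_FP dropLF_mem_FP)))))))

/-- **Output size of `swapAdjLF`**: `≤ |l| + 4|x| + 4`. [folklore] -/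
theorem length_swapAdjLF_le (z : List Bool) : (swapAdjLF z).length ≤ (sndPow 1 z).length + 4 * (fstF z).length + 4 := by
  rw [swapAdjLF, Function.comp_apply]
  set w := fanoutFn fstF (fanoutFn (nthF 1) (fanoutFn takeRevLF
    (fanoutFn (fstF ∘ sndF ∘ dropLF) (fanoutFn (fstF ∘ dropLF) (sndF ∘ sndF ∘ dropLF))))) z with hw
  have h := length_revOntoLF_le w
  have e2 : nthF 2 w = takeRevLF z := by simp [hw]
  have e3 : sndPow 2 w = boolPair (fstF (sndF (dropLF z))) (boolPair (fstF (dropLF z)) (sndF (sndF (dropLF z)))) := by simp [hw]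
  have e0 : fstF w = fstF z := by simp [hw]
  rw [e2, e3, e0, length_boolPair, length_boolPair] at h
  have hj := length_takeRevLF_add_dropLF_le z
  have h1 := length_fstF_sndF_le (dropLF z)
  have h2 := length_fstF_sndF_le (sndF (dropLF z))
  omega

/-! ### Map -/

/-- Body of `mapRevLF f` on `⟨x, ⟨cnt, ⟨prm, ⟨rest, acc⟩⟩⟩⟩`: if `rest` is empty keep the state, else
`⟨prm, ⟨tl rest, ⟨f ⟨x, ⟨prm, hd rest⟩⟩, acc⟩⟩⟩`. [folklore] -/
noncomputable def mapRevBody (f : List Bool → List Bool) : List Bool → List Bool :=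
  iteFn (isNilFn ∘ nthF 3) (sndPow 1)
    (fanoutFn (nthF 2) (fanoutFn (sndF ∘ nthF 3)
      (fanoutFn (f ∘ fanoutFn (nthF 0) (fanoutFn (nthF 2) (fstF ∘ nthF 3))) (sndPow 3))))

/-- The loop record of `mapRevLF`: `⟨x, ⟨cnt, ⟨prm, ⟨l, ε⟩⟩⟩⟩` from `⟨x, ⟨cnt, ⟨prm, l⟩⟩⟩`. [folklore] -/
noncomputable def mapInit : List Bool → List Bool :=
  fanoutFn fstF (fanoutFn (nthF 1) (fanoutFn (nthF 2) (fanoutFn (sndPow 2) (fun _ => []))))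

/-- `mapRevLF f`: from `⟨x, ⟨cnt, ⟨prm, l⟩⟩⟩`, the reversed list of the images of the first `⟦cnt⟧`
items under `a ↦ f ⟨x, ⟨prm, a⟩⟩`. [cite: AroraBarak2009, §1.3 (bounded loops)] -/
noncomputable def mapRevLF (f : List Bool → List Bool) : List Bool → List Bool :=
  sndPow 3 ∘ loopX (mapRevBody f) ∘ mapInit

/-- `mapInit` spelled out. [folklore] -/
theorem mapInit_eq (z : List Bool) :
    mapInit z = boolPair (fstF z) (boolPair (nthF 1 z) (boolPair (nthF 2 z) (boolPair (sndPow 2 z) []))) := by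
  simp [mapInit]

/-- `mapInit ∈ FP`. [folklore] -/
theorem mapInit_mem_FP : mapInit ∈ FP :=
  fanoutFn_mem_FP fstF_mem_FP (fanoutFn_mem_FP (nthF_mem_FP 1) (fanoutFn_mem_FP (nthF_mem_FP 2)
    (fanoutFn_mem_FP (sndPow_mem_FP 2) (const_mem_FP _))))

/-- The map body on a record with an arbitrary state `s` (`prm = fstF s`, `rest = nthF 1 s`,
`acc = sndPow 1 s`). [folklore] -/
theorem mapRevBody_state (f : List Bool → List Bool) (x c s : List Bool) :
    mapRevBody f (boolPair x (boolPair c s)) =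
      if nthF 1 s = [] then s
      else boolPair (fstF s) (boolPair (sndF (nthF 1 s)) (boolPair (f (boolPair x (boolPair (fstF s) (fstF (nthF 1 s))))) (sndPow 1 s))) := by
  rw [mapRevBody, iteFn_of_oneBit (oneBit_isNilFn.comp _)]
  by_cases h : nthF 1 s = []
  · rw [if_pos (by simp [isNilFn, nthF] at h ⊢; exact h), if_pos h]; simp [sndPow]
  · rw [if_neg (by simp [isNilFn, nthF] at h ⊢; exact h), if_neg h]; simp [nthF, sndPow]

/-- The map body on a record whose state is `⟨prm, ⟨rest, acc⟩⟩`. [folklore] -/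
theorem mapRevBody_record (f : List Bool → List Bool) (x c prm rest acc : List Bool) :
    mapRevBody f (boolPair x (boolPair c (boolPair prm (boolPair rest acc)))) =
      if rest = [] then boolPair prm (boolPair rest acc)
      else boolPair prm (boolPair (sndF rest) (boolPair (f (boolPair x (boolPair prm (fstF rest)))) acc)) := by
  rw [mapRevBody_state]; simp [nthF, sndPow]

/-- The model of the map loop. [folklore] -/
theorem loopModel_mapRevBody (f : List Bool → List Bool) (x prm : List Bool) : ∀ (k : ℕ) (L : List (List Bool)) (A : List (List Bool)),
    loopModel (mapRevBody f) x k (boolPair prm (boolPair (encList L) (encList A))) =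
      boolPair prm (boolPair (encList (L.drop k)) (encList (((L.take k).map fun a => f (boolPair x (boolPair prm a))).reverse ++ A)))
  | 0, L, A => by simp [loopModel]
  | k + 1, [], A => by
    rw [loopModel, mapRevBody_record, if_pos (by simp), loopModel_mapRevBody f x prm k [] A]; simp
  | k + 1, a :: L, A => by
    rw [loopModel, mapRevBody_record, if_neg (by simp [encList_cons, boolPair])]
    simp only [encList_cons, fstF_boolPair, sndF_boolPair]
    rw [← encList_cons, loopModel_mapRevBody f x prm k L _]
    simp

/-- **Semantics of `mapRevLF`** (`k ≤ |x|`). [folklore] -/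
theorem mapRevLF_apply (f : List Bool → List Bool) (x prm : List Bool) {k : ℕ} (hk : k ≤ x.length) (L : List (List Bool)) :
    mapRevLF f (boolPair x (boolPair (encodeNat k) (boolPair prm (encList L)))) =
      encList ((L.take k).map fun a => f (boolPair x (boolPair prm a))).reverse := by
  have h := loopModel_mapRevBody f x prm k L []
  rw [mapRevLF, Function.comp_apply, Function.comp_apply, mapInit_eq]
  simp only [fstF_boolPair, nthF_succ_boolPair, nthF_zero_boolPair, sndPow_succ_boolPair, sndPow_zero, sndF_boolPair]
  rw [show boolPair (encList L) [] = boolPair (encList L) (encList []) from rfl, loopX_apply _ _ _ hk, h]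
  simp

/-- `mapRevLF f` in terms of the run. [folklore] -/
theorem mapRevLF_eq (f : List Bool → List Bool) (z : List Bool) :
    mapRevLF f z = sndPow 1 (loopRun (mapRevBody f) (fstF z) (nthF 1 z) (fstF z).length (boolPair (nthF 2 z) (boolPair (sndPow 2 z) []))) := by
  rw [mapRevLF, Function.comp_apply, Function.comp_apply, mapInit_eq, loopX_record]; simp

/-- **One round of the map loop under a weighted potential**: with an item function of output
`≤ w|a| + K`, the potential `w|rest| + |acc|` grows by at most `2K + 2`. [folklore] -/
theorem potential_mapRevBody {f : List Bool → List Bool} {x : List Bool} {w K : ℕ}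
    (hf : ∀ p a, (f (boolPair x (boolPair p a))).length ≤ w * a.length + K) (c s : List Bool) (_hc : c ≠ []) :
    w * (nthF 1 (mapRevBody f (boolPair x (boolPair c s)))).length + (sndPow 1 (mapRevBody f (boolPair x (boolPair c s)))).length ≤
      (w * (nthF 1 s).length + (sndPow 1 s).length) + (2 * K + 2) := by
  rw [mapRevBody_state]
  split_ifs with h
  · omega
  · have h1 := hf (fstF s) (fstF (nthF 1 s))
    have h2 := length_fstF_sndF_le (nthF 1 s)
    have h3 : w * (2 * (fstF (nthF 1 s)).length + (sndF (nthF 1 s)).length) ≤ w * (nthF 1 s).length := Nat.mul_le_mul_left w h2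
    simp only [nthF_succ_boolPair, nthF_zero_boolPair, sndPow_succ_boolPair, sndPow_zero, sndF_boolPair, length_boolPair]
    nlinarith

/-- **Output size of `mapRevLF f`** for an item function with `|f ⟨x, ⟨p, a⟩⟩| ≤ w|a| + P(|x|)`:
`≤ w|l| + |x|(2P(|x|) + 2)` (`l = sndPow 2 z`). [folklore] -/
theorem length_mapRevLF_le {f : List Bool → List Bool} (w : ℕ) {P : Polynomial ℕ}
    (hf : ∀ x p a, (f (boolPair x (boolPair p a))).length ≤ w * a.length + P.eval x.length) (z : List Bool) :
    (mapRevLF f z).length ≤ w * (sndPow 2 z).length + (fstF z).length * (2 * P.eval (fstF z).length + 2) := by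
  rw [mapRevLF_eq]
  have hpot := potential_loopRun_le (body := mapRevBody f) (x := fstF z)
    (fun S => w * (nthF 1 S).length + (sndPow 1 S).length) (2 * P.eval (fstF z).length + 2)
    (fun c s hc => potential_mapRevBody (fun p a => hf (fstF z) p a) c s hc) (fstF z).length (nthF 1 z)
    (boolPair (nthF 2 z) (boolPair (sndPow 2 z) []))
  have hact := Nat.mul_le_mul_right (2 * P.eval (fstF z).length + 2) (activeRounds_le (nthF 1 z) (fstF z).length)
  simp only [nthF_succ_boolPair, nthF_zero_boolPair, sndPow_succ_boolPair, sndPow_zero, sndF_boolPair, List.length_nil,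
    add_zero] at hpot
  have hw : 0 ≤ w * (nthF 1 (loopRun (mapRevBody f) (fstF z) (nthF 1 z) (fstF z).length
    (boolPair (nthF 2 z) (boolPair (sndPow 2 z) [])))).length := Nat.zero_le _
  omega

/-- Growth of the map body (total length), for weights `w ≤ 2`: `≤ 2P(|x|) + 6` per round. [folklore] -/
theorem length_mapRevBody_le {f : List Bool → List Bool} {w : ℕ} (hw : w ≤ 2) {P : Polynomial ℕ}
    (hf : ∀ x p a, (f (boolPair x (boolPair p a))).length ≤ w * a.length + P.eval x.length) (z : List Bool) :
    (mapRevBody f z).length ≤ (sndPow 1 z).length + (2 * P + 6).eval (fstF z).length := by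
  have h1 := length_nthF_succ_add_sndPow_succ_le 1 z
  have h2 := length_nthF_succ_add_sndPow_succ_le 2 z
  have h3 := length_fstF_sndF_le (nthF 3 z)
  have h4 := hf (nthF 0 z) (nthF 2 z) (fstF (nthF 3 z))
  have h5 : w * (fstF (nthF 3 z)).length ≤ 2 * (fstF (nthF 3 z)).length := Nat.mul_le_mul_right _ hw
  rw [mapRevBody, iteFn_of_oneBit (oneBit_isNilFn.comp _)]
  split_ifs
  · simp
  · simp only [fanoutFn_apply, length_boolPair, Function.comp_apply, eval_add, eval_mul, eval_ofNat, nthF_zero,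
      Nat.reduceAdd] at h4 h1 h2 ⊢
    omega

/-- `mapRevLF f ∈ FP` (weights `w ≤ 2`). [folklore] -/
theorem mapRevLF_mem_FP {f : List Bool → List Bool} (hF : f ∈ FP) {w : ℕ} (hw : w ≤ 2) {P : Polynomial ℕ}
    (hf : ∀ x p a, (f (boolPair x (boolPair p a))).length ≤ w * a.length + P.eval x.length) : mapRevLF f ∈ FP :=
  comp_mem_FP (sndPow_mem_FP 3) (comp_mem_FP
    (loopX_mem_FP
      (iteFn_mem_FP (comp_mem_FP isNilFn_mem_FP (nthF_mem_FP 3)) (sndPow_mem_FP 1)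
        (fanoutFn_mem_FP (nthF_mem_FP 2) (fanoutFn_mem_FP (comp_mem_FP sndF_mem_FP (nthF_mem_FP 3))
          (fanoutFn_mem_FP (comp_mem_FP hF (fanoutFn_mem_FP (nthF_mem_FP 0) (fanoutFn_mem_FP (nthF_mem_FP 2) (comp_mem_FP fstF_mem_FP (nthF_mem_FP 3)))))
            (sndPow_mem_FP 3)))))
      (length_mapRevBody_le hw hf))
    mapInit_mem_FP)

/-- **`mapLF f`**: the images, in order: `⟨x, ⟨cnt, ⟨prm, l⟩⟩⟩ ↦ takeRev cnt (mapRev …)`.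
[cite: AroraBarak2009, §1.3 (bounded loops)] -/
noncomputable def mapLF (f : List Bool → List Bool) : List Bool → List Bool :=
  takeRevLF ∘ fanoutFn fstF (fanoutFn (nthF 1) (mapRevLF f))

/-- **Semantics of `mapLF`** (`k ≤ |x|`): `encList ((L.take k).map (a ↦ f ⟨x, ⟨prm, a⟩⟩))`. [folklore] -/
theorem mapLF_apply (f : List Bool → List Bool) (x prm : List Bool) {k : ℕ} (hk : k ≤ x.length) (L : List (List Bool)) :
    mapLF f (boolPair x (boolPair (encodeNat k) (boolPair prm (encList L)))) =
      encList ((L.take k).map fun a => f (boolPair x (boolPair prm a))) := by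
  simp only [mapLF, Function.comp_apply, fanoutFn_apply, fstF_boolPair, nthF_succ_boolPair, nthF_zero_boolPair]
  rw [mapRevLF_apply f x prm hk, takeRevLF_apply x hk, List.take_of_length_le (by simp)]
  simp

/-- `mapLF f ∈ FP`. [folklore] -/
theorem mapLF_mem_FP {f : List Bool → List Bool} (hF : f ∈ FP) {w : ℕ} (hw : w ≤ 2) {P : Polynomial ℕ}
    (hf : ∀ x p a, (f (boolPair x (boolPair p a))).length ≤ w * a.length + P.eval x.length) : mapLF f ∈ FP :=
  comp_mem_FP takeRevLF_mem_FP (fanoutFn_mem_FP fstF_mem_FP (fanoutFn_mem_FP (nthF_mem_FP 1) (mapRevLF_mem_FP hF hw hf)))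

/-- **Output size of `mapLF f`**: `≤ w|l| + |x|(2P(|x|) + 4)`. [folklore] -/
theorem length_mapLF_le {f : List Bool → List Bool} (w : ℕ) {P : Polynomial ℕ}
    (hf : ∀ x p a, (f (boolPair x (boolPair p a))).length ≤ w * a.length + P.eval x.length) (z : List Bool) :
    (mapLF f z).length ≤ w * (sndPow 2 z).length + (fstF z).length * (2 * P.eval (fstF z).length + 4) := by
  rw [mapLF, Function.comp_apply, fanoutFn_apply, fanoutFn_apply]
  have h := length_takeRevLF_le (boolPair (fstF z) (boolPair (nthF 1 z) (mapRevLF f z)))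
  simp only [fstF_boolPair, sndPow_succ_boolPair, sndPow_zero, sndF_boolPair] at h
  have hm := length_mapRevLF_le w hf z
  nlinarith

/-! ### ZipWith -/

/-- Body of `zipRevLF f` on `⟨x, ⟨cnt, ⟨prm, ⟨r₁, ⟨r₂, acc⟩⟩⟩⟩⟩`: if `r₁` or `r₂` is empty keep the state,
else `⟨prm, ⟨tl r₁, ⟨tl r₂, ⟨f ⟨x, ⟨prm, ⟨hd r₁, hd r₂⟩⟩⟩, acc⟩⟩⟩⟩`. [folklore] -/
noncomputable def zipRevBody (f : List Bool → List Bool) : List Bool → List Bool :=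
  iteFn (isNilFn ∘ nthF 3) (sndPow 1)
    (iteFn (isNilFn ∘ nthF 4) (sndPow 1)
      (fanoutFn (nthF 2) (fanoutFn (sndF ∘ nthF 3) (fanoutFn (sndF ∘ nthF 4)
        (fanoutFn (f ∘ fanoutFn (nthF 0) (fanoutFn (nthF 2) (fanoutFn (fstF ∘ nthF 3) (fstF ∘ nthF 4)))) (sndPow 4))))))

/-- The loop record of `zipRevLF`: `⟨x, ⟨cnt, ⟨prm, ⟨l₁, ⟨l₂, ε⟩⟩⟩⟩⟩` from `⟨x, ⟨cnt, ⟨prm, ⟨l₁, l₂⟩⟩⟩⟩`. [folklore] -/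
noncomputable def zipInit : List Bool → List Bool :=
  fanoutFn fstF (fanoutFn (nthF 1) (fanoutFn (nthF 2) (fanoutFn (nthF 3) (fanoutFn (sndPow 3) (fun _ => [])))))

/-- `zipRevLF f`: from `⟨x, ⟨cnt, ⟨prm, ⟨l₁, l₂⟩⟩⟩⟩`, the reversed list of
`f ⟨x, ⟨prm, ⟨aᵢ, bᵢ⟩⟩⟩` over the first `⟦cnt⟧` pairs of items. [cite: AroraBarak2009, §1.3 (bounded loops)] -/
noncomputable def zipRevLF (f : List Bool → List Bool) : List Bool → List Bool :=
  sndPow 4 ∘ loopX (zipRevBody f) ∘ zipInit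

/-- `zipInit` spelled out. [folklore] -/
theorem zipInit_eq (z : List Bool) : zipInit z =
    boolPair (fstF z) (boolPair (nthF 1 z) (boolPair (nthF 2 z) (boolPair (nthF 3 z) (boolPair (sndPow 3 z) [])))) := by
  simp [zipInit]

/-- `zipInit ∈ FP`. [folklore] -/
theorem zipInit_mem_FP : zipInit ∈ FP :=
  fanoutFn_mem_FP fstF_mem_FP (fanoutFn_mem_FP (nthF_mem_FP 1) (fanoutFn_mem_FP (nthF_mem_FP 2)
    (fanoutFn_mem_FP (nthF_mem_FP 3) (fanoutFn_mem_FP (sndPow_mem_FP 3) (const_mem_FP _)))))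

/-- The zipped images. [folklore] -/
def zipImages (f : List Bool → List Bool) (x prm : List Bool) (L₁ L₂ : List (List Bool)) : List (List Bool) :=
  List.zipWith (fun a b => f (boolPair x (boolPair prm (boolPair a b)))) L₁ L₂

/-- The zip body on a record with an arbitrary state `s` (`prm = fstF s`, `r₁ = nthF 1 s`,
`r₂ = nthF 2 s`, `acc = sndPow 2 s`). [folklore] -/
theorem zipRevBody_state (f : List Bool → List Bool) (x c s : List Bool) :
    zipRevBody f (boolPair x (boolPair c s)) =
      if nthF 1 s = [] then s else if nthF 2 s = [] then s
      else boolPair (fstF s) (boolPair (sndF (nthF 1 s)) (boolPair (sndF (nthF 2 s))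
        (boolPair (f (boolPair x (boolPair (fstF s) (boolPair (fstF (nthF 1 s)) (fstF (nthF 2 s)))))) (sndPow 2 s)))) := by
  rw [zipRevBody, iteFn_of_oneBit (oneBit_isNilFn.comp _)]
  by_cases h : nthF 1 s = []
  · rw [if_pos (by simp [isNilFn, nthF] at h ⊢; exact h), if_pos h]; simp [sndPow]
  · rw [if_neg (by simp [isNilFn, nthF] at h ⊢; exact h), if_neg h, iteFn_of_oneBit (oneBit_isNilFn.comp _)]
    by_cases h' : nthF 2 s = []
    · rw [if_pos (by simp [isNilFn, nthF] at h' ⊢; exact h'), if_pos h']; simp [sndPow]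
    · rw [if_neg (by simp [isNilFn, nthF] at h' ⊢; exact h'), if_neg h']; simp [nthF, sndPow]

/-- The zip body on a record whose state is `⟨prm, ⟨r₁, ⟨r₂, acc⟩⟩⟩`. [folklore] -/
theorem zipRevBody_record (f : List Bool → List Bool) (x c prm r₁ r₂ acc : List Bool) :
    zipRevBody f (boolPair x (boolPair c (boolPair prm (boolPair r₁ (boolPair r₂ acc))))) =
      if r₁ = [] then boolPair prm (boolPair r₁ (boolPair r₂ acc)) else if r₂ = [] then boolPair prm (boolPair r₁ (boolPair r₂ acc))
      else boolPair prm (boolPair (sndF r₁) (boolPair (sndF r₂)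
        (boolPair (f (boolPair x (boolPair prm (boolPair (fstF r₁) (fstF r₂))))) acc))) := by
  rw [zipRevBody_state]; simp [nthF, sndPow]

/-- The model of the zip loop. [folklore] -/
theorem loopModel_zipRevBody (f : List Bool → List Bool) (x prm : List Bool) :
    ∀ (k : ℕ) (L₁ L₂ : List (List Bool)) (A : List (List Bool)), ∃ R₁ R₂ : List (List Bool),
    loopModel (zipRevBody f) x k (boolPair prm (boolPair (encList L₁) (boolPair (encList L₂) (encList A)))) =
      boolPair prm (boolPair (encList R₁) (boolPair (encList R₂) (encList ((zipImages f x prm (L₁.take k) (L₂.take k)).reverse ++ A))))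
  | 0, L₁, L₂, A => ⟨L₁, L₂, by simp [loopModel, zipImages]⟩
  | k + 1, [], L₂, A => by
    obtain ⟨R₁, R₂, h⟩ := loopModel_zipRevBody f x prm k [] L₂ A
    refine ⟨R₁, R₂, ?_⟩
    rw [loopModel, zipRevBody_record, if_pos (by simp), h]
    simp [zipImages]
  | k + 1, a :: L₁, [], A => by
    obtain ⟨R₁, R₂, h⟩ := loopModel_zipRevBody f x prm k (a :: L₁) [] A
    refine ⟨R₁, R₂, ?_⟩
    rw [loopModel, zipRevBody_record, if_neg (by simp [encList_cons, boolPair]), if_pos (by simp), h]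
    simp [zipImages]
  | k + 1, a :: L₁, b :: L₂, A => by
    obtain ⟨R₁, R₂, h⟩ := loopModel_zipRevBody f x prm k L₁ L₂ (f (boolPair x (boolPair prm (boolPair a b))) :: A)
    refine ⟨R₁, R₂, ?_⟩
    rw [loopModel, zipRevBody_record, if_neg (by simp [encList_cons, boolPair]), if_neg (by simp [encList_cons, boolPair])]
    simp only [encList_cons, fstF_boolPair, sndF_boolPair]
    rw [← encList_cons, h]
    simp [zipImages]

/-- **Semantics of `zipRevLF`** (`k ≤ |x|`). [folklore] -/
theorem zipRevLF_apply (f : List Bool → List Bool) (x prm : List Bool) {k : ℕ} (hk : k ≤ x.length) (L₁ L₂ : List (List Bool)) :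
    zipRevLF f (boolPair x (boolPair (encodeNat k) (boolPair prm (boolPair (encList L₁) (encList L₂))))) =
      encList (zipImages f x prm (L₁.take k) (L₂.take k)).reverse := by
  obtain ⟨R₁, R₂, h⟩ := loopModel_zipRevBody f x prm k L₁ L₂ []
  rw [zipRevLF, Function.comp_apply, Function.comp_apply, zipInit_eq]
  simp only [fstF_boolPair, nthF_succ_boolPair, nthF_zero_boolPair, sndPow_succ_boolPair, sndPow_zero, sndF_boolPair]
  rw [show boolPair (encList L₂) [] = boolPair (encList L₂) (encList []) from rfl, loopX_apply _ _ _ hk, h]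
  simp

/-- `zipRevLF f` in terms of the run. [folklore] -/
theorem zipRevLF_eq (f : List Bool → List Bool) (z : List Bool) :
    zipRevLF f z = sndPow 2 (loopRun (zipRevBody f) (fstF z) (nthF 1 z) (fstF z).length
      (boolPair (nthF 2 z) (boolPair (nthF 3 z) (boolPair (sndPow 3 z) [])))) := by
  rw [zipRevLF, Function.comp_apply, Function.comp_apply, zipInit_eq, loopX_record]; simp

/-- **One round of the zip loop under a weighted potential**: with an item function of output
`≤ w(|a| + |b|) + K`, the potential `w(|r₁| + |r₂|) + |acc|` grows by at most `2K + 2`. [folklore] -/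
theorem potential_zipRevBody {f : List Bool → List Bool} {x : List Bool} {w K : ℕ}
    (hf : ∀ p a b, (f (boolPair x (boolPair p (boolPair a b)))).length ≤ w * (a.length + b.length) + K)
    (c s : List Bool) (_hc : c ≠ []) :
    w * ((nthF 1 (zipRevBody f (boolPair x (boolPair c s)))).length + (nthF 2 (zipRevBody f (boolPair x (boolPair c s)))).length) +
        (sndPow 2 (zipRevBody f (boolPair x (boolPair c s)))).length ≤
      (w * ((nthF 1 s).length + (nthF 2 s).length) + (sndPow 2 s).length) + (2 * K + 2) := by
  rw [zipRevBody_state]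
  split_ifs with h h'
  · omega
  · omega
  · have h1 := hf (fstF s) (fstF (nthF 1 s)) (fstF (nthF 2 s))
    have h2 := length_fstF_sndF_le (nthF 1 s)
    have h2' := length_fstF_sndF_le (nthF 2 s)
    have h3 : w * (2 * (fstF (nthF 1 s)).length + (sndF (nthF 1 s)).length + (2 * (fstF (nthF 2 s)).length + (sndF (nthF 2 s)).length)) ≤
        w * ((nthF 1 s).length + (nthF 2 s).length) := Nat.mul_le_mul_left w (Nat.add_le_add h2 h2')
    simp only [nthF_succ_boolPair, nthF_zero_boolPair, sndPow_succ_boolPair, sndPow_zero, sndF_boolPair, length_boolPair]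
    nlinarith

/-- **Output size of `zipRevLF f`** for an item function with `|f ⟨x, ⟨p, ⟨a, b⟩⟩⟩| ≤ w(|a| + |b|) + P(|x|)`:
`≤ w(|l₁| + |l₂|) + |x|(2P(|x|) + 2)` (`l₁ = nthF 3 z`, `l₂ = sndPow 3 z`). [folklore] -/
theorem length_zipRevLF_le {f : List Bool → List Bool} (w : ℕ) {P : Polynomial ℕ}
    (hf : ∀ x p a b, (f (boolPair x (boolPair p (boolPair a b)))).length ≤ w * (a.length + b.length) + P.eval x.length)
    (z : List Bool) :
    (zipRevLF f z).length ≤ w * ((nthF 3 z).length + (sndPow 3 z).length) + (fstF z).length * (2 * P.eval (fstF z).length + 2) := by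
  rw [zipRevLF_eq]
  have hpot := potential_loopRun_le (body := zipRevBody f) (x := fstF z)
    (fun S => w * ((nthF 1 S).length + (nthF 2 S).length) + (sndPow 2 S).length) (2 * P.eval (fstF z).length + 2)
    (fun c s hc => potential_zipRevBody (fun p a b => hf (fstF z) p a b) c s hc) (fstF z).length (nthF 1 z)
    (boolPair (nthF 2 z) (boolPair (nthF 3 z) (boolPair (sndPow 3 z) [])))
  have hact := Nat.mul_le_mul_right (2 * P.eval (fstF z).length + 2) (activeRounds_le (nthF 1 z) (fstF z).length)
  simp only [nthF_succ_boolPair, nthF_zero_boolPair, sndPow_succ_boolPair, sndPow_zero, sndF_boolPair, List.length_nil,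
    add_zero] at hpot
  have hw : 0 ≤ w * ((nthF 1 (loopRun (zipRevBody f) (fstF z) (nthF 1 z) (fstF z).length
      (boolPair (nthF 2 z) (boolPair (nthF 3 z) (boolPair (sndPow 3 z) []))))).length +
      (nthF 2 (loopRun (zipRevBody f) (fstF z) (nthF 1 z) (fstF z).length
      (boolPair (nthF 2 z) (boolPair (nthF 3 z) (boolPair (sndPow 3 z) []))))).length) := Nat.zero_le _
  omega

/-- Growth of the zip body (total length), for weights `w ≤ 2`: `≤ 2P(|x|) + 8` per round. [folklore] -/
theorem length_zipRevBody_le {f : List Bool → List Bool} {w : ℕ} (hw : w ≤ 2) {P : Polynomial ℕ}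
    (hf : ∀ x p a b, (f (boolPair x (boolPair p (boolPair a b)))).length ≤ w * (a.length + b.length) + P.eval x.length)
    (z : List Bool) :
    (zipRevBody f z).length ≤ (sndPow 1 z).length + (2 * P + 8).eval (fstF z).length := by
  have h1 := length_nthF_succ_add_sndPow_succ_le 1 z
  have h2 := length_nthF_succ_add_sndPow_succ_le 2 z
  have h2' := length_nthF_succ_add_sndPow_succ_le 3 z
  have h3 := length_fstF_sndF_le (nthF 3 z)
  have h3' := length_fstF_sndF_le (nthF 4 z)
  have h4 := hf (nthF 0 z) (nthF 2 z) (fstF (nthF 3 z)) (fstF (nthF 4 z))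
  have h5 : w * ((fstF (nthF 3 z)).length + (fstF (nthF 4 z)).length) ≤ 2 * ((fstF (nthF 3 z)).length + (fstF (nthF 4 z)).length) :=
    Nat.mul_le_mul_right _ hw
  rw [zipRevBody, iteFn_of_oneBit (oneBit_isNilFn.comp _)]
  split_ifs
  · simp
  · rw [iteFn_of_oneBit (oneBit_isNilFn.comp _)]
    split_ifs
    · simp
    · simp only [fanoutFn_apply, length_boolPair, Function.comp_apply, eval_add, eval_mul, eval_ofNat, nthF_zero,
        Nat.reduceAdd] at h4 h1 h2 h2' ⊢
      omega

/-- `zipRevLF f ∈ FP` (weights `w ≤ 2`). [folklore] -/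
theorem zipRevLF_mem_FP {f : List Bool → List Bool} (hF : f ∈ FP) {w : ℕ} (hw : w ≤ 2) {P : Polynomial ℕ}
    (hf : ∀ x p a b, (f (boolPair x (boolPair p (boolPair a b)))).length ≤ w * (a.length + b.length) + P.eval x.length) :
    zipRevLF f ∈ FP :=
  comp_mem_FP (sndPow_mem_FP 4) (comp_mem_FP
    (loopX_mem_FP
      (iteFn_mem_FP (comp_mem_FP isNilFn_mem_FP (nthF_mem_FP 3)) (sndPow_mem_FP 1)
        (iteFn_mem_FP (comp_mem_FP isNilFn_mem_FP (nthF_mem_FP 4)) (sndPow_mem_FP 1)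
          (fanoutFn_mem_FP (nthF_mem_FP 2) (fanoutFn_mem_FP (comp_mem_FP sndF_mem_FP (nthF_mem_FP 3))
            (fanoutFn_mem_FP (comp_mem_FP sndF_mem_FP (nthF_mem_FP 4))
              (fanoutFn_mem_FP (comp_mem_FP hF (fanoutFn_mem_FP (nthF_mem_FP 0) (fanoutFn_mem_FP (nthF_mem_FP 2)
                (fanoutFn_mem_FP (comp_mem_FP fstF_mem_FP (nthF_mem_FP 3)) (comp_mem_FP fstF_mem_FP (nthF_mem_FP 4))))))
                (sndPow_mem_FP 4)))))))
      (length_zipRevBody_le hw hf))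
    zipInit_mem_FP)

/-- **`zipLF f`**: the zipped images in order. [cite: AroraBarak2009, §1.3 (bounded loops)] -/
noncomputable def zipLF (f : List Bool → List Bool) : List Bool → List Bool :=
  takeRevLF ∘ fanoutFn fstF (fanoutFn (nthF 1) (zipRevLF f))

/-- **Semantics of `zipLF`** (`k ≤ |x|`): `encList (zipWith _ (L₁.take k) (L₂.take k))`. [folklore] -/
theorem zipLF_apply (f : List Bool → List Bool) (x prm : List Bool) {k : ℕ} (hk : k ≤ x.length) (L₁ L₂ : List (List Bool)) :
    zipLF f (boolPair x (boolPair (encodeNat k) (boolPair prm (boolPair (encList L₁) (encList L₂))))) =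
      encList (zipImages f x prm (L₁.take k) (L₂.take k)) := by
  simp only [zipLF, Function.comp_apply, fanoutFn_apply, fstF_boolPair, nthF_succ_boolPair, nthF_zero_boolPair]
  rw [zipRevLF_apply f x prm hk, takeRevLF_apply x hk, List.take_of_length_le]
  · simp
  · simp only [List.length_reverse, zipImages, List.length_zipWith, List.length_take]; omega

/-- `zipLF f ∈ FP`. [folklore] -/
theorem zipLF_mem_FP {f : List Bool → List Bool} (hF : f ∈ FP) {w : ℕ} (hw : w ≤ 2) {P : Polynomial ℕ}
    (hf : ∀ x p a b, (f (boolPair x (boolPair p (boolPair a b)))).length ≤ w * (a.length + b.length) + P.eval x.length) :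
    zipLF f ∈ FP :=
  comp_mem_FP takeRevLF_mem_FP (fanoutFn_mem_FP fstF_mem_FP (fanoutFn_mem_FP (nthF_mem_FP 1) (zipRevLF_mem_FP hF hw hf)))

/-- **Output size of `zipLF f`**: `≤ w(|l₁| + |l₂|) + |x|(2P(|x|) + 4)`. [folklore] -/
theorem length_zipLF_le {f : List Bool → List Bool} (w : ℕ) {P : Polynomial ℕ}
    (hf : ∀ x p a b, (f (boolPair x (boolPair p (boolPair a b)))).length ≤ w * (a.length + b.length) + P.eval x.length)
    (z : List Bool) :
    (zipLF f z).length ≤ w * ((nthF 3 z).length + (sndPow 3 z).length) + (fstF z).length * (2 * P.eval (fstF z).length + 4) := by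
  rw [zipLF, Function.comp_apply, fanoutFn_apply, fanoutFn_apply]
  have h := length_takeRevLF_le (boolPair (fstF z) (boolPair (nthF 1 z) (zipRevLF f z)))
  simp only [fstF_boolPair, sndPow_succ_boolPair, sndPow_zero, sndF_boolPair] at h
  have hm := length_zipRevLF_le w hf z
  nlinarith

/-! ### Fold over two lists (dot products) -/

/-- Body of `zipFoldLF f` on `⟨x, ⟨cnt, ⟨prm, ⟨r₁, ⟨r₂, acc⟩⟩⟩⟩⟩`: if `r₁` or `r₂` is empty keep the state,
else `⟨prm, ⟨tl r₁, ⟨tl r₂, f ⟨x, ⟨prm, ⟨hd r₁, ⟨hd r₂, acc⟩⟩⟩⟩⟩⟩⟩`. [folklore] -/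
noncomputable def zipFoldBody (f : List Bool → List Bool) : List Bool → List Bool :=
  iteFn (isNilFn ∘ nthF 3) (sndPow 1)
    (iteFn (isNilFn ∘ nthF 4) (sndPow 1)
      (fanoutFn (nthF 2) (fanoutFn (sndF ∘ nthF 3) (fanoutFn (sndF ∘ nthF 4)
        (f ∘ fanoutFn (nthF 0) (fanoutFn (nthF 2) (fanoutFn (fstF ∘ nthF 3) (fanoutFn (fstF ∘ nthF 4) (sndPow 4)))))))))

/-- The loop record of `zipFoldLF` is its input `⟨x, ⟨cnt, ⟨prm, ⟨l₁, ⟨l₂, init⟩⟩⟩⟩⟩`, re-packed. [folklore] -/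
noncomputable def zipFoldInit : List Bool → List Bool :=
  fanoutFn fstF (fanoutFn (nthF 1) (fanoutFn (nthF 2) (fanoutFn (nthF 3) (fanoutFn (nthF 4) (sndPow 4)))))

/-- `zipFoldLF f`: from `⟨x, ⟨cnt, ⟨prm, ⟨l₁, ⟨l₂, init⟩⟩⟩⟩⟩`, the left fold of
`(acc, a, b) ↦ f ⟨x, ⟨prm, ⟨a, ⟨b, acc⟩⟩⟩⟩` over the first `⟦cnt⟧` pairs of items. [cite: AroraBarak2009, §1.3 (bounded loops)] -/
noncomputable def zipFoldLF (f : List Bool → List Bool) : List Bool → List Bool :=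
  sndPow 4 ∘ loopX (zipFoldBody f) ∘ zipFoldInit

/-- `zipFoldInit` spelled out. [folklore] -/
theorem zipFoldInit_eq (z : List Bool) : zipFoldInit z =
    boolPair (fstF z) (boolPair (nthF 1 z) (boolPair (nthF 2 z) (boolPair (nthF 3 z) (boolPair (nthF 4 z) (sndPow 4 z))))) := by
  simp [zipFoldInit]

/-- `zipFoldInit ∈ FP`. [folklore] -/
theorem zipFoldInit_mem_FP : zipFoldInit ∈ FP :=
  fanoutFn_mem_FP fstF_mem_FP (fanoutFn_mem_FP (nthF_mem_FP 1) (fanoutFn_mem_FP (nthF_mem_FP 2)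
    (fanoutFn_mem_FP (nthF_mem_FP 3) (fanoutFn_mem_FP (nthF_mem_FP 4) (sndPow_mem_FP 4)))))

/-- The folded value over two lists. [folklore] -/
def zipFoldValue (f : List Bool → List Bool) (x prm : List Bool) (L₁ L₂ : List (List Bool)) (init : List Bool) : List Bool :=
  (List.zip L₁ L₂).foldl (fun acc ab => f (boolPair x (boolPair prm (boolPair ab.1 (boolPair ab.2 acc))))) init

/-- The zip-fold body on a record with an arbitrary state `s`. [folklore] -/
theorem zipFoldBody_state (f : List Bool → List Bool) (x c s : List Bool) :
    zipFoldBody f (boolPair x (boolPair c s)) =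
      if nthF 1 s = [] then s else if nthF 2 s = [] then s
      else boolPair (fstF s) (boolPair (sndF (nthF 1 s)) (boolPair (sndF (nthF 2 s))
        (f (boolPair x (boolPair (fstF s) (boolPair (fstF (nthF 1 s)) (boolPair (fstF (nthF 2 s)) (sndPow 2 s)))))))) := by
  rw [zipFoldBody, iteFn_of_oneBit (oneBit_isNilFn.comp _)]
  by_cases h : nthF 1 s = []
  · rw [if_pos (by simp [isNilFn, nthF] at h ⊢; exact h), if_pos h]; simp [sndPow]
  · rw [if_neg (by simp [isNilFn, nthF] at h ⊢; exact h), if_neg h, iteFn_of_oneBit (oneBit_isNilFn.comp _)]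
    by_cases h' : nthF 2 s = []
    · rw [if_pos (by simp [isNilFn, nthF] at h' ⊢; exact h'), if_pos h']; simp [sndPow]
    · rw [if_neg (by simp [isNilFn, nthF] at h' ⊢; exact h'), if_neg h']; simp [nthF, sndPow]

/-- The zip-fold body on a record whose state is `⟨prm, ⟨r₁, ⟨r₂, acc⟩⟩⟩`. [folklore] -/
theorem zipFoldBody_record (f : List Bool → List Bool) (x c prm r₁ r₂ acc : List Bool) :
    zipFoldBody f (boolPair x (boolPair c (boolPair prm (boolPair r₁ (boolPair r₂ acc))))) =
      if r₁ = [] then boolPair prm (boolPair r₁ (boolPair r₂ acc)) else if r₂ = [] then boolPair prm (boolPair r₁ (boolPair r₂ acc))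
      else boolPair prm (boolPair (sndF r₁) (boolPair (sndF r₂)
        (f (boolPair x (boolPair prm (boolPair (fstF r₁) (boolPair (fstF r₂) acc))))))) := by
  rw [zipFoldBody_state]; simp [nthF, sndPow]

/-- The model of the zip-fold loop. [folklore] -/
theorem loopModel_zipFoldBody (f : List Bool → List Bool) (x prm : List Bool) :
    ∀ (k : ℕ) (L₁ L₂ : List (List Bool)) (acc : List Bool), ∃ R₁ R₂ : List (List Bool),
    loopModel (zipFoldBody f) x k (boolPair prm (boolPair (encList L₁) (boolPair (encList L₂) acc))) =
      boolPair prm (boolPair (encList R₁) (boolPair (encList R₂) (zipFoldValue f x prm (L₁.take k) (L₂.take k) acc)))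
  | 0, L₁, L₂, acc => ⟨L₁, L₂, by simp [loopModel, zipFoldValue]⟩
  | k + 1, [], L₂, acc => by
    obtain ⟨R₁, R₂, h⟩ := loopModel_zipFoldBody f x prm k [] L₂ acc
    refine ⟨R₁, R₂, ?_⟩
    rw [loopModel, zipFoldBody_record, if_pos (by simp), h]
    simp [zipFoldValue]
  | k + 1, a :: L₁, [], acc => by
    obtain ⟨R₁, R₂, h⟩ := loopModel_zipFoldBody f x prm k (a :: L₁) [] acc
    refine ⟨R₁, R₂, ?_⟩
    rw [loopModel, zipFoldBody_record, if_neg (by simp [encList_cons, boolPair]), if_pos (by simp), h]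
    simp [zipFoldValue]
  | k + 1, a :: L₁, b :: L₂, acc => by
    obtain ⟨R₁, R₂, h⟩ := loopModel_zipFoldBody f x prm k L₁ L₂ (f (boolPair x (boolPair prm (boolPair a (boolPair b acc)))))
    refine ⟨R₁, R₂, ?_⟩
    rw [loopModel, zipFoldBody_record, if_neg (by simp [encList_cons, boolPair]), if_neg (by simp [encList_cons, boolPair])]
    simp only [encList_cons, fstF_boolPair, sndF_boolPair]
    rw [h]
    simp [zipFoldValue]

/-- **Semantics of `zipFoldLF`** (`k ≤ |x|`). [folklore] -/
theorem zipFoldLF_apply (f : List Bool → List Bool) (x prm : List Bool) {k : ℕ} (hk : k ≤ x.length)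
    (L₁ L₂ : List (List Bool)) (init : List Bool) :
    zipFoldLF f (boolPair x (boolPair (encodeNat k) (boolPair prm (boolPair (encList L₁) (boolPair (encList L₂) init))))) =
      zipFoldValue f x prm (L₁.take k) (L₂.take k) init := by
  obtain ⟨R₁, R₂, h⟩ := loopModel_zipFoldBody f x prm k L₁ L₂ init
  rw [zipFoldLF, Function.comp_apply, Function.comp_apply, zipFoldInit_eq]
  simp only [fstF_boolPair, nthF_succ_boolPair, nthF_zero_boolPair, sndPow_succ_boolPair, sndPow_zero, sndF_boolPair]
  rw [loopX_apply _ _ _ hk, h]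
  simp

/-- `zipFoldLF f` in terms of the run. [folklore] -/
theorem zipFoldLF_eq (f : List Bool → List Bool) (z : List Bool) :
    zipFoldLF f z = sndPow 2 (loopRun (zipFoldBody f) (fstF z) (nthF 1 z) (fstF z).length
      (boolPair (nthF 2 z) (boolPair (nthF 3 z) (boolPair (nthF 4 z) (sndPow 4 z))))) := by
  rw [zipFoldLF, Function.comp_apply, Function.comp_apply, zipFoldInit_eq, loopX_record]; simp

/-- **One round of the zip-fold loop**: with `|f ⟨x, ⟨p, ⟨a, ⟨b, acc⟩⟩⟩⟩| ≤ |acc| + 2(|a| + |b|) + K`, the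
potential `|r₁| + |r₂| + |acc|` grows by at most `K`. [folklore] -/
theorem potential_zipFoldBody {f : List Bool → List Bool} {x : List Bool} {K : ℕ}
    (hf : ∀ p a b acc, (f (boolPair x (boolPair p (boolPair a (boolPair b acc))))).length ≤ acc.length + 2 * (a.length + b.length) + K)
    (c s : List Bool) (_hc : c ≠ []) :
    (nthF 1 (zipFoldBody f (boolPair x (boolPair c s)))).length + (nthF 2 (zipFoldBody f (boolPair x (boolPair c s)))).length +
        (sndPow 2 (zipFoldBody f (boolPair x (boolPair c s)))).length ≤
      ((nthF 1 s).length + (nthF 2 s).length + (sndPow 2 s).length) + K := by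
  rw [zipFoldBody_state]
  split_ifs with h h'
  · omega
  · omega
  · have h1 := hf (fstF s) (fstF (nthF 1 s)) (fstF (nthF 2 s)) (sndPow 2 s)
    have h2 := length_fstF_sndF_le (nthF 1 s)
    have h2' := length_fstF_sndF_le (nthF 2 s)
    simp only [nthF_succ_boolPair, nthF_zero_boolPair, sndPow_succ_boolPair, sndPow_zero, sndF_boolPair]
    omega

/-- **Output size of `zipFoldLF f`**: `≤ |l₁| + |l₂| + |init| + |x| P(|x|)`. [folklore] -/
theorem length_zipFoldLF_le {f : List Bool → List Bool} {P : Polynomial ℕ}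
    (hf : ∀ x p a b acc, (f (boolPair x (boolPair p (boolPair a (boolPair b acc))))).length ≤
      acc.length + 2 * (a.length + b.length) + P.eval x.length) (z : List Bool) :
    (zipFoldLF f z).length ≤ (nthF 3 z).length + (nthF 4 z).length + (sndPow 4 z).length + (fstF z).length * P.eval (fstF z).length := by
  rw [zipFoldLF_eq]
  have hpot := potential_loopRun_le (body := zipFoldBody f) (x := fstF z)
    (fun S => (nthF 1 S).length + (nthF 2 S).length + (sndPow 2 S).length) (P.eval (fstF z).length)
    (fun c s hc => potential_zipFoldBody (fun p a b acc => hf (fstF z) p a b acc) c s hc) (fstF z).length (nthF 1 z)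
    (boolPair (nthF 2 z) (boolPair (nthF 3 z) (boolPair (nthF 4 z) (sndPow 4 z))))
  have hact := Nat.mul_le_mul_right (P.eval (fstF z).length) (activeRounds_le (nthF 1 z) (fstF z).length)
  simp only [nthF_succ_boolPair, nthF_zero_boolPair, sndPow_succ_boolPair, sndPow_zero, sndF_boolPair] at hpot
  omega

/-- Growth of the zip-fold body (total length): `≤ P(|x|) + 6` per round. [folklore] -/
theorem length_zipFoldBody_le {f : List Bool → List Bool} {P : Polynomial ℕ}
    (hf : ∀ x p a b acc, (f (boolPair x (boolPair p (boolPair a (boolPair b acc))))).length ≤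
      acc.length + 2 * (a.length + b.length) + P.eval x.length) (z : List Bool) :
    (zipFoldBody f z).length ≤ (sndPow 1 z).length + (P + 6).eval (fstF z).length := by
  have h1 := length_nthF_succ_add_sndPow_succ_le 1 z
  have h2 := length_nthF_succ_add_sndPow_succ_le 2 z
  have h2' := length_nthF_succ_add_sndPow_succ_le 3 z
  have h3 := length_fstF_sndF_le (nthF 3 z)
  have h3' := length_fstF_sndF_le (nthF 4 z)
  have h4 := hf (nthF 0 z) (nthF 2 z) (fstF (nthF 3 z)) (fstF (nthF 4 z)) (sndPow 4 z)
  rw [zipFoldBody, iteFn_of_oneBit (oneBit_isNilFn.comp _)]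
  split_ifs
  · simp
  · rw [iteFn_of_oneBit (oneBit_isNilFn.comp _)]
    split_ifs
    · simp
    · simp only [fanoutFn_apply, length_boolPair, Function.comp_apply, eval_add, eval_ofNat, nthF_zero, Nat.reduceAdd] at h4 h1 h2 h2' ⊢
      omega

/-- `zipFoldLF f ∈ FP`. [folklore] -/
theorem zipFoldLF_mem_FP {f : List Bool → List Bool} (hF : f ∈ FP) {P : Polynomial ℕ}
    (hf : ∀ x p a b acc, (f (boolPair x (boolPair p (boolPair a (boolPair b acc))))).length ≤
      acc.length + 2 * (a.length + b.length) + P.eval x.length) : zipFoldLF f ∈ FP :=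
  comp_mem_FP (sndPow_mem_FP 4) (comp_mem_FP
    (loopX_mem_FP
      (iteFn_mem_FP (comp_mem_FP isNilFn_mem_FP (nthF_mem_FP 3)) (sndPow_mem_FP 1)
        (iteFn_mem_FP (comp_mem_FP isNilFn_mem_FP (nthF_mem_FP 4)) (sndPow_mem_FP 1)
          (fanoutFn_mem_FP (nthF_mem_FP 2) (fanoutFn_mem_FP (comp_mem_FP sndF_mem_FP (nthF_mem_FP 3))
            (fanoutFn_mem_FP (comp_mem_FP sndF_mem_FP (nthF_mem_FP 4))
              (comp_mem_FP hF (fanoutFn_mem_FP (nthF_mem_FP 0) (fanoutFn_mem_FP (nthF_mem_FP 2)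
                (fanoutFn_mem_FP (comp_mem_FP fstF_mem_FP (nthF_mem_FP 3))
                  (fanoutFn_mem_FP (comp_mem_FP fstF_mem_FP (nthF_mem_FP 4)) (sndPow_mem_FP 4)))))))))))
      (length_zipFoldBody_le hf))
    zipFoldInit_mem_FP)

end Brick

end Literature.Computability.Complexity
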